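import Summits.Ventures.LatticeQCDFlow.Scaling.TightSectorKLogKFloor

/-!
HONEST FRAMING: exact (Metropolis-corrected) sampling algorithms for lattice gauge theory; figures
of merit are autocorrelation/cost numbers at stated couplings and volumes; no continuum-physics
claim.

# TightSectorTwoStageStructure — THE MAP-ASSISTED HUB HAS THE TWO-STAGE STRUCTURE: WITH THE COLD COUNT `V(x) = #{k : x_{k+1} ∈ A}` AND THE HUB BIT
# `b(x) = [x_0 ∈ A]`, FROM AN UNLABELLED HUB `V` DROPS ONLY BY LABELLING THE HUB, FROM A LABELLED HUB `V` NEVER DROPS, THE DEATH MASS IS `≤ (1−t)w_0`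
# (ANY HOT KERNEL) AND THE PUSH-BACK MASS IS `≥ (t·c·p/(m·p'))·(K − V)` (lean-2 GEN-29, ours)

Venture-side (OURS).  Cell `lqcd-flow` (pub-lqcd), unit `pub-lqcd-lean-2-g29`, 2026-08-28.  Chapter O, file 13: the structural half of the refresh
budget's `log K` (the hypotheses of `Scaling/TwoStageCountFloor`, O11, verified for the chapter-M/N scheme); the assembly with the explicit
super-solution of `Scaling/TwoStageSuperSolution` (O12) is the sequel `Scaling/TightSectorRefreshKLogK` (O14).  Every transition of the scheme either
keeps the census `[x_0 ∈ A] + V(x)` (swaps with `A`-preserving maps, chapter K) or moves one coordinate with positive update weight, which at a cold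
level never crosses `A` (sector-idle kernels); the hot update alone can unlabel the hub; and a labelled hub is proposed to each entry of an
unlabelled replica with probability `1/m` and accepted with probability `≥ p/p'` (one-sided domination `p` at the light content, pointwise tightness
`p'` at the label), every unlabelled replica carrying `≥ c` entries.

## What is proved

* `labelCount_update_succ_eq` (one-coordinate census), `scheme_step_cases`, `idle_pointwise`, `labelCount_le_of_update`.
* **`tightSector_twoStage_S0`**, **`tightSector_twoStage_S1`** — the skip-free structure from an unlabelled / labelled hub.
* **`tightSector_twoStage_R1`** — death mass `≤ (1−t)·w_0`; **`tightSector_twoStage_R2`** — push-back mass `≥ (t·c·p/(m·p'))·(K − V(x))`.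

Reading (no numerics implied): bookkeeping only; the floor is in the sequel.  NOT CLAIMED: anything measured.  Literature grade (cell rule): OWN
LEMMAS; nothing cited as a fact; no new bib keys.
-/

noncomputable section

open Finset Function
open Literature.Probability.MarkovChains

namespace Summit.Ventures.LatticeQCDFlow.Scaling

variable {S : Type*} [Fintype S] [DecidableEq S] {K m : ℕ} {μ : Fin (K + 1) → S → ℝ} {M : Fin (K + 1) → S → S → ℝ}
  {w : Fin (K + 1) → ℝ} {t p : ℝ}

/-! ## §1 Census bookkeeping -/

omit [Fintype S] in
/-- **One-coordinate census at a cold level:** `V(x^{j+1←v}) + [x_{j+1} ∈ A] = V(x) + [v ∈ A]`. [ours] -/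
theorem labelCount_update_succ_eq (A : Finset S) (x : Fin (K + 1) → S) (j : Fin K) (v : S) :
    (univ.filter (fun k : Fin K => update x j.succ v k.succ ∈ A)).card + (if x j.succ ∈ A then 1 else 0)
      = (univ.filter (fun k : Fin K => x k.succ ∈ A)).card + (if v ∈ A then 1 else 0) := by
  -- split both filters at `k = j`
  have hsplit : ∀ (y : Fin (K + 1) → S), (univ.filter (fun k : Fin K => y k.succ ∈ A)).card
      = ((univ.erase j).filter (fun k : Fin K => y k.succ ∈ A)).card + (if y j.succ ∈ A then 1 else 0) := by
    intro y
    have h := Finset.card_filter_add_card_filter_not (s := univ.filter (fun k : Fin K => y k.succ ∈ A)) (fun k => k = j)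
    rw [Finset.filter_filter, Finset.filter_filter] at h
    have h1 : (univ.filter (fun k : Fin K => y k.succ ∈ A ∧ k = j)).card = (if y j.succ ∈ A then 1 else 0) := by
      split_ifs with hy
      · rw [Finset.card_eq_one]; refine ⟨j, ?_⟩; ext k; simp only [mem_filter, mem_univ, true_and, mem_singleton]
        exact ⟨fun h => h.2, fun h => ⟨h ▸ hy, h⟩⟩
      · rw [Finset.card_eq_zero, Finset.filter_eq_empty_iff]; intro k _ ⟨hk, hkj⟩; exact hy (hkj ▸ hk)
    have h2 : (univ.filter (fun k : Fin K => y k.succ ∈ A ∧ ¬k = j)) = (univ.erase j).filter (fun k : Fin K => y k.succ ∈ A) := by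
      ext k; simp only [mem_filter, mem_univ, true_and, mem_erase]; tauto
    rw [h1, h2] at h
    omega
  rw [hsplit (update x j.succ v), hsplit x, update_self]
  have hrest : ((univ.erase j).filter (fun k : Fin K => update x j.succ v k.succ ∈ A))
      = ((univ.erase j).filter (fun k : Fin K => x k.succ ∈ A)) := by
    refine Finset.filter_congr fun k hk => ?_
    rw [update_of_ne (fun h => (Finset.ne_of_mem_erase hk) (Fin.succ_injective _ h))]
  rw [hrest]
  omega

section Star
variable (κ : Fin m → Fin K) (φ : Fin m → Equiv.Perm S)

/-- **A transition of the scheme keeps the full census or moves one coordinate with positive update weight.** [ours] -/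
theorem scheme_step_cases (hμ : ∀ k x, 0 < μ k x) {A : Finset S} (hφA : ∀ r u, φ r u ∈ A ↔ u ∈ A) (x y : Fin (K + 1) → S)
    (hxy : t * ptGraphSwap μ (fun r : Fin m => (((0 : Fin (K + 1)), (κ r).succ) : Fin (K + 1) × Fin (K + 1))) φ x y
      + (1 - t) * prodKernel w M x y ≠ 0) :
    ((if y 0 ∈ A then (1 : ℝ) else 0) + ((univ.filter (fun k : Fin K => y k.succ ∈ A)).card : ℝ)
        = (if x 0 ∈ A then (1 : ℝ) else 0) + ((univ.filter (fun k : Fin K => x k.succ ∈ A)).card : ℝ))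
      ∨ (∃ j : Fin (K + 1), y = update x j (y j) ∧ w j * M j (x j) (y j) ≠ 0) := by
  have he : ∀ r : Fin m, ((fun r : Fin m => (((0 : Fin (K + 1)), (κ r).succ) : Fin (K + 1) × Fin (K + 1))) r).1
      ≠ ((fun r : Fin m => (((0 : Fin (K + 1)), (κ r).succ) : Fin (K + 1) × Fin (K + 1))) r).2 :=
    fun r => (Fin.succ_ne_zero (κ r)).symm
  by_cases hsw : ptGraphSwap μ (fun r : Fin m => (((0 : Fin (K + 1)), (κ r).succ) : Fin (K + 1) × Fin (K + 1))) φ x y ≠ 0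
  · left
    have h := ptGraphSwap_sectorCount_eq he hμ hφA x y hsw
    rw [labelCensus_eq, labelCensus_eq] at h
    exact h
  · right
    rw [not_ne_iff] at hsw
    rw [hsw, mul_zero, zero_add] at hxy
    have hprod : prodKernel w M x y ≠ 0 := fun h => hxy (by rw [h, mul_zero])
    rw [prodKernel_apply] at hprod
    obtain ⟨j, -, hj⟩ := Finset.exists_ne_zero_of_sum_ne_zero hprod
    have hcoord : coordKernel M j x y ≠ 0 := fun h => hj (by rw [h, mul_zero])
    have hyupd : y = update x j (y j) := by
      unfold coordKernel at hcoord; by_contra h; exact hcoord (if_neg h)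
    refine ⟨j, hyupd, ?_⟩
    have hval : coordKernel M j x y = M j (x j) (y j) := by
      unfold coordKernel; rw [if_pos hyupd]
    rw [hval] at hj
    exact hj

/-- From `w_k·Q_k(A,Aᶜ) = 0`: `w_k·M_k(z,v) = 0` for `z ∈ A`, `v ∉ A` (positive laws). [ours] -/
theorem idle_pointwise (hμ : ∀ k x, 0 < μ k x) (hM : ∀ k, IsRowStochastic (M k)) {A : Finset S} (k : Fin (K + 1))
    (hidle : w k * edgeMeasure (μ k) (M k) A Aᶜ = 0) {z v : S} (hz : z ∈ A) (hv : v ∉ A) :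
    w k * M k z v = 0 := by
  rcases mul_eq_zero.mp hidle with hw | hQ
  · rw [hw, zero_mul]
  · unfold edgeMeasure at hQ
    have hterm := (Finset.sum_eq_zero_iff_of_nonneg (fun z' _ => sum_nonneg fun v' _ =>
      mul_nonneg (hμ _ z').le ((hM k).1 z' v'))).mp hQ z hz
    have hterm' := (Finset.sum_eq_zero_iff_of_nonneg (fun v' _ => mul_nonneg (hμ _ _).le ((hM k).1 _ v'))).mp hterm v
      (Finset.mem_compl.mpr hv)
    rcases mul_eq_zero.mp hterm' with h0 | h0
    · exact absurd h0 (hμ _ _).ne'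
    · rw [h0, mul_zero]

/-- **A one-coordinate move with positive weight never lowers the cold count** (sector-idle cold kernels). [ours] -/
theorem labelCount_le_of_update (hμ : ∀ k x, 0 < μ k x) (hM : ∀ k, IsRowStochastic (M k)) {A : Finset S}
    (hidle : ∀ k : Fin (K + 1), k ≠ 0 → w k * edgeMeasure (μ k) (M k) A Aᶜ = 0) (x y : Fin (K + 1) → S) (j : Fin (K + 1))
    (hyupd : y = update x j (y j)) (hwM : w j * M j (x j) (y j) ≠ 0) :
    (univ.filter (fun k : Fin K => x k.succ ∈ A)).card ≤ (univ.filter (fun k : Fin K => y k.succ ∈ A)).card := by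
  rw [hyupd]
  cases j using Fin.cases with
  | zero => rw [labelCount_update_zero]
  | succ j =>
    have h := labelCount_update_succ_eq A x j (y j.succ)
    by_cases hxj : x j.succ ∈ A
    · by_cases hv : y j.succ ∈ A
      · rw [if_pos hxj, if_pos hv] at h; omega
      · exact absurd (idle_pointwise hμ hM j.succ (hidle _ (Fin.succ_ne_zero j)) hxj hv) hwM
    · rw [if_neg hxj] at h
      have : 0 ≤ (if y j.succ ∈ A then 1 else 0) := by split_ifs <;> norm_num
      omega

/-! ## §2 The two-stage structure of the hub -/

/-- **(S0) From an unlabelled hub the cold count drops by at most one, and a drop labels the hub.** [ours] -/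
theorem tightSector_twoStage_S0 (hμ : ∀ k x, 0 < μ k x) (hM : ∀ k, IsRowStochastic (M k)) {A : Finset S}
    (hφA : ∀ r u, φ r u ∈ A ↔ u ∈ A) (hidle : ∀ k : Fin (K + 1), k ≠ 0 → w k * edgeMeasure (μ k) (M k) A Aᶜ = 0)
    (x y : Fin (K + 1) → S) (hbx : decide (x 0 ∈ A) = false)
    (hxy : t * ptGraphSwap μ (fun r : Fin m => (((0 : Fin (K + 1)), (κ r).succ) : Fin (K + 1) × Fin (K + 1))) φ x y
      + (1 - t) * prodKernel w M x y ≠ 0) :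
    (univ.filter (fun k : Fin K => x k.succ ∈ A)).card ≤ (univ.filter (fun k : Fin K => y k.succ ∈ A)).card + 1
      ∧ ((univ.filter (fun k : Fin K => y k.succ ∈ A)).card + 1 = (univ.filter (fun k : Fin K => x k.succ ∈ A)).card
          → decide (y 0 ∈ A) = true) := by
  have hx0 : x 0 ∉ A := by simpa using hbx
  rcases scheme_step_cases κ φ hμ hφA x y hxy with hcensus | ⟨j, hyupd, hwM⟩
  · rw [if_neg hx0, zero_add] at hcensus
    refine ⟨?_, fun hdrop => ?_⟩
    · have : (if y 0 ∈ A then (1 : ℝ) else 0) ≤ 1 := by split_ifs <;> norm_num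
      have h2 : ((univ.filter (fun k : Fin K => x k.succ ∈ A)).card : ℝ) ≤ (univ.filter (fun k : Fin K => y k.succ ∈ A)).card + 1 := by
        linarith
      exact_mod_cast h2
    · have hc : ((univ.filter (fun k : Fin K => y k.succ ∈ A)).card : ℝ) + 1 = (univ.filter (fun k : Fin K => x k.succ ∈ A)).card := by
        exact_mod_cast hdrop
      by_cases hy0 : y 0 ∈ A
      · simpa using hy0
      · rw [if_neg hy0] at hcensus; linarith
  · have hle := labelCount_le_of_update hμ hM hidle x y j hyupd hwM
    exact ⟨by omega, fun h => by omega⟩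

/-- **(S1) From a labelled hub the cold count never drops.** [ours] -/
theorem tightSector_twoStage_S1 (hμ : ∀ k x, 0 < μ k x) (hM : ∀ k, IsRowStochastic (M k)) {A : Finset S}
    (hφA : ∀ r u, φ r u ∈ A ↔ u ∈ A) (hidle : ∀ k : Fin (K + 1), k ≠ 0 → w k * edgeMeasure (μ k) (M k) A Aᶜ = 0)
    (x y : Fin (K + 1) → S) (hbx : decide (x 0 ∈ A) = true)
    (hxy : t * ptGraphSwap μ (fun r : Fin m => (((0 : Fin (K + 1)), (κ r).succ) : Fin (K + 1) × Fin (K + 1))) φ x y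
      + (1 - t) * prodKernel w M x y ≠ 0) :
    (univ.filter (fun k : Fin K => x k.succ ∈ A)).card ≤ (univ.filter (fun k : Fin K => y k.succ ∈ A)).card := by
  have hx0 : x 0 ∈ A := by simpa using hbx
  rcases scheme_step_cases κ φ hμ hφA x y hxy with hcensus | ⟨j, hyupd, hwM⟩
  · rw [if_pos hx0] at hcensus
    have : (if y 0 ∈ A then (1 : ℝ) else 0) ≤ 1 := by split_ifs <;> norm_num
    have h2 : ((univ.filter (fun k : Fin K => x k.succ ∈ A)).card : ℝ) ≤ (univ.filter (fun k : Fin K => y k.succ ∈ A)).card := by linarith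
    exact_mod_cast h2
  · exact labelCount_le_of_update hμ hM hidle x y j hyupd hwM

/-- **(R1) The death mass: from a labelled hub, the transitions that unlabel it without changing the cold count weigh at most `(1−t)·w_0`**
(any hot kernel). [ours] -/
theorem tightSector_twoStage_R1 (hμ : ∀ k x, 0 < μ k x) (hM : ∀ k, IsRowStochastic (M k)) (hw0 : ∀ k, 0 ≤ w k) (hw1 : ∑ k, w k = 1)
    (ht1 : t ≤ 1) {A : Finset S} (hφA : ∀ r u, φ r u ∈ A ↔ u ∈ A) (x : Fin (K + 1) → S) (hbx : decide (x 0 ∈ A) = true) :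
    ∑ y ∈ univ.filter (fun y : Fin (K + 1) → S => decide (y 0 ∈ A) = false
        ∧ (univ.filter (fun k : Fin K => y k.succ ∈ A)).card = (univ.filter (fun k : Fin K => x k.succ ∈ A)).card),
      (t * ptGraphSwap μ (fun r : Fin m => (((0 : Fin (K + 1)), (κ r).succ) : Fin (K + 1) × Fin (K + 1))) φ x y
        + (1 - t) * prodKernel w M x y) ≤ (1 - t) * w 0 := by
  have hx0 : x 0 ∈ A := by simpa using hbx
  set e : Fin m → Fin (K + 1) × Fin (K + 1) := fun r => (((0 : Fin (K + 1)), (κ r).succ) : Fin (K + 1) × Fin (K + 1))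
    with he_def
  have he : ∀ r, (e r).1 ≠ (e r).2 := fun r => (Fin.succ_ne_zero (κ r)).symm
  set V : (Fin (K + 1) → S) → ℕ := fun y => (univ.filter (fun k : Fin K => y k.succ ∈ A)).card with hV
  -- the swap part vanishes on the filter (census)
  have hsw : ∀ y ∈ univ.filter (fun y : Fin (K + 1) → S => decide (y 0 ∈ A) = false ∧ V y = V x), ptGraphSwap μ e φ x y = 0 := by
    intro y hy
    obtain ⟨hy0, hVy⟩ := (mem_filter.mp hy).2
    have hy0' : y 0 ∉ A := by simpa using hy0
    by_contra hne
    have h := ptGraphSwap_sectorCount_eq he hμ hφA x y hne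
    rw [labelCensus_eq, labelCensus_eq, if_pos hx0, if_neg hy0'] at h
    have : (V y : ℝ) = V x := by exact_mod_cast hVy
    rw [hV] at this
    simp only at this
    linarith
  have hsplit : ∑ y ∈ univ.filter (fun y : Fin (K + 1) → S => decide (y 0 ∈ A) = false ∧ V y = V x),
      (t * ptGraphSwap μ e φ x y + (1 - t) * prodKernel w M x y)
      = (1 - t) * ∑ y ∈ univ.filter (fun y : Fin (K + 1) → S => decide (y 0 ∈ A) = false ∧ V y = V x), prodKernel w M x y := by
    rw [Finset.sum_add_distrib, ← Finset.mul_sum, ← Finset.mul_sum, Finset.sum_eq_zero hsw, mul_zero, zero_add]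
  rw [hsplit]
  refine mul_le_mul_of_nonneg_left ?_ (by linarith)
  -- the product part: only the hot coordinate can unlabel the hub
  have hU := prodKernel_isRowStochastic M w hw0 hw1 hM
  calc ∑ y ∈ univ.filter (fun y : Fin (K + 1) → S => decide (y 0 ∈ A) = false ∧ V y = V x), prodKernel w M x y
      ≤ ∑ y ∈ univ.filter (fun y : Fin (K + 1) → S => y 0 ∉ A), prodKernel w M x y := by
        refine Finset.sum_le_sum_of_subset_of_nonneg (fun y hy => ?_) (fun y _ _ => hU.1 x y)
        have h := (mem_filter.mp hy).2.1
        exact mem_filter.mpr ⟨mem_univ _, by simpa using h⟩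
    _ = ∑ y, prodKernel w M x y * (if y 0 ∉ A then (1 : ℝ) else 0) := by
        rw [Finset.sum_filter]; exact sum_congr rfl fun y _ => by split_ifs <;> simp
    _ = ∑ j, w j * ∑ v, M j (x j) v * (if update x j v 0 ∉ A then (1 : ℝ) else 0) := sum_prodKernel_mul (P := M) w x _
    _ ≤ w 0 := by
        rw [Fin.sum_univ_succ]
        have hcold : ∑ j : Fin K, w j.succ * ∑ v, M j.succ (x j.succ) v * (if update x j.succ v 0 ∉ A then (1 : ℝ) else 0) = 0 := by
          refine Finset.sum_eq_zero fun j _ => ?_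
          rw [Finset.sum_eq_zero (fun v _ => by rw [update_of_ne (Fin.succ_ne_zero j).symm, if_neg (not_not.mpr hx0), mul_zero]),
            mul_zero]
        rw [hcold, add_zero]
        have h1 : ∑ v, M 0 (x 0) v * (if update x 0 v 0 ∉ A then (1 : ℝ) else 0) ≤ 1 := by
          calc ∑ v, M 0 (x 0) v * (if update x 0 v 0 ∉ A then (1 : ℝ) else 0) ≤ ∑ v, M 0 (x 0) v :=
                sum_le_sum fun v _ => by
                  have := (hM 0).1 (x 0) v
                  split_ifs <;> nlinarith
            _ = 1 := (hM 0).2 (x 0)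
        calc w 0 * ∑ v, M 0 (x 0) v * (if update x 0 v 0 ∉ A then (1 : ℝ) else 0) ≤ w 0 * 1 :=
              mul_le_mul_of_nonneg_left h1 (hw0 0)
          _ = w 0 := mul_one _

/-- **(R2) The push-back mass: from a labelled hub, the transitions raising the cold count weigh at least `(t·c·p/(m·p'))·(K − V(x))`**
(one-sided domination `p`, pointwise tightness `p'` on `A`, every cold level listed `≥ c` times, `0 ≤ t`). [ours] -/
theorem tightSector_twoStage_R2 (hm : 1 ≤ m) (hμ : ∀ k x, 0 < μ k x) (hM : ∀ k, IsRowStochastic (M k)) (hw0 : ∀ k, 0 ≤ w k)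
    (ht0 : 0 ≤ t) (ht1 : t ≤ 1) (hp0 : 0 < p) (hdom : ∀ r u, p * μ (κ r).succ (φ r u) ≤ μ 0 u)
    {c : ℕ} (hc : ∀ k : Fin K, c ≤ (univ.filter (fun r : Fin m => κ r = k)).card)
    {A : Finset S} (hφA : ∀ r u, φ r u ∈ A ↔ u ∈ A) {p' : ℝ} (hp' : 0 < p')
    (htight : ∀ r, ∀ z ∈ A, μ 0 ((φ r).symm z) ≤ p' * μ (κ r).succ z) (x : Fin (K + 1) → S) (hbx : decide (x 0 ∈ A) = true) :
    t * c * p / (m * p') * ((K - (univ.filter (fun k : Fin K => x k.succ ∈ A)).card : ℕ) : ℝ)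
      ≤ ∑ y ∈ univ.filter (fun y : Fin (K + 1) → S =>
          (univ.filter (fun k : Fin K => x k.succ ∈ A)).card + 1 ≤ (univ.filter (fun k : Fin K => y k.succ ∈ A)).card),
        (t * ptGraphSwap μ (fun r : Fin m => (((0 : Fin (K + 1)), (κ r).succ) : Fin (K + 1) × Fin (K + 1))) φ x y
          + (1 - t) * prodKernel w M x y) := by
  have hx0 : x 0 ∈ A := by simpa using hbx
  have hmpos : (0 : ℝ) < m := Nat.cast_pos.mpr (by omega)
  set e : Fin m → Fin (K + 1) × Fin (K + 1) := fun r => (((0 : Fin (K + 1)), (κ r).succ) : Fin (K + 1) × Fin (K + 1))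
    with he_def
  have he : ∀ r, (e r).1 ≠ (e r).2 := fun r => (Fin.succ_ne_zero (κ r)).symm
  set V : (Fin (K + 1) → S) → ℕ := fun y => (univ.filter (fun k : Fin K => y k.succ ∈ A)).card with hV
  set F := univ.filter (fun y : Fin (K + 1) → S => V x + 1 ≤ V y) with hF
  have hπ := tensorFun_pos hμ
  -- `p ≤ p'` (at the label `φ_r x_0 ∈ A`, any entry; entries exist when `K ≥ 1`; if there is no light level the claim is trivial)
  -- Step 1: `P ≥ t·GSw` termwise
  have hstep1 : t * ∑ y ∈ F, ptGraphSwap μ e φ x y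
      ≤ ∑ y ∈ F, (t * ptGraphSwap μ e φ x y + (1 - t) * prodKernel w M x y) := by
    rw [Finset.mul_sum]
    refine sum_le_sum fun y _ => ?_
    have h : 0 ≤ prodKernel w M x y := by
      rw [prodKernel_apply]
      exact sum_nonneg fun j _ => mul_nonneg (hw0 j) (coordKernel_nonneg M (fun k u v => (hM k).1 u v) j _ _)
    nlinarith
  refine le_trans ?_ hstep1
  -- Step 2: the swap mass on `F` is `(1/m)·Σ_r [swap_r x ∈ F]·min{1, π̃(swap_r x)/π̃(x)}`
  have hxF : x ∉ F := by rw [hF, mem_filter]; intro h; omega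
  have hoff : ∀ y ∈ F, ptGraphSwap μ e φ x y
      = ∑ r : Fin m, (if y = edgeFlowSwap (φ r) (e r).1 (e r).2 x then (1 : ℝ) / m else 0) * min 1 (tensorFun μ y / tensorFun μ x) := by
    intro y hy
    have hyx : y ≠ x := fun h => hxF (h ▸ hy)
    have h := tensorFun_mul_ptGraphSwap (e := e) (φ := φ) hμ he hyx
    have hπx := hπ x
    have e1 : ptGraphSwap μ e φ x y = ptGraphProposal e φ x y * min 1 (tensorFun μ y / tensorFun μ x) := by
      have : min (tensorFun μ x) (tensorFun μ y) = tensorFun μ x * min 1 (tensorFun μ y / tensorFun μ x) := by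
        rw [mul_min_of_nonneg _ _ hπx.le, mul_one, mul_div_cancel₀ _ hπx.ne']
      rw [this] at h
      field_simp at h
      linarith [h]
    rw [e1]; unfold ptGraphProposal; rw [Finset.sum_mul]
  rw [sum_congr rfl hoff, Finset.sum_comm]
  -- Step 3: each entry at an unlabelled level contributes `≥ (1/m)·(p/p')`
  have hentry : ∀ r : Fin m, (if x (κ r).succ ∉ A then (1 : ℝ) / m * (p / p') else 0)
      ≤ ∑ y ∈ F, (if y = edgeFlowSwap (φ r) (e r).1 (e r).2 x then (1 : ℝ) / m else 0) * min 1 (tensorFun μ y / tensorFun μ x) := by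
    intro r
    set y₀ := edgeFlowSwap (φ r) (e r).1 (e r).2 x with hy₀
    have hterm : ∀ y, (if y = y₀ then (1 : ℝ) / m else 0) * min 1 (tensorFun μ y / tensorFun μ x)
        = if y = y₀ then (1 : ℝ) / m * min 1 (tensorFun μ y / tensorFun μ x) else 0 := by
      intro y; split_ifs <;> ring
    simp_rw [hterm]
    rw [Finset.sum_ite_eq' F y₀]
    by_cases hl : x (κ r).succ ∉ A
    · -- the swap raises the count and is accepted with probability `≥ p/p'`
      have hy0F : y₀ ∈ F := by
        rw [hF, mem_filter]
        refine ⟨mem_univ _, ?_⟩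
        -- `V(y₀) = V(x) + 1`
        have h1 : y₀ = update (update x 0 ((φ r).symm (x (κ r).succ))) (κ r).succ (φ r (x 0)) := rfl
        have h2 := labelCount_update_succ_eq A (update x 0 ((φ r).symm (x (κ r).succ))) (κ r) (φ r (x 0))
        rw [← h1, labelCount_update_zero, update_of_ne (Fin.succ_ne_zero _), if_neg hl, if_pos ((hφA r _).2 hx0)] at h2
        show V x + 1 ≤ V y₀
        rw [hV]; simp only; omega
      rw [if_pos hl, if_pos hy0F]
      refine mul_le_mul_of_nonneg_left ?_ (by positivity)
      -- the ratio: `π̃(y₀)/π̃(x) ≥ p/p'`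
      have hsw := tensorFun_edgeFlowSwap_mul μ (φ r) (he r) x
      have hpos : 0 < μ 0 (x 0) * μ (κ r).succ (x (κ r).succ) := mul_pos (hμ _ _) (hμ _ _)
      have h1 : p * μ (κ r).succ (x (κ r).succ) ≤ μ 0 ((φ r).symm (x (κ r).succ)) := by
        have := hdom r ((φ r).symm (x (κ r).succ)); rwa [Equiv.apply_symm_apply] at this
      have h2 : μ 0 (x 0) ≤ p' * μ (κ r).succ (φ r (x 0)) := by
        have := htight r (φ r (x 0)) ((hφA r _).2 hx0); rwa [Equiv.symm_apply_apply] at this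
      have hratio : p / p' ≤ tensorFun μ y₀ / tensorFun μ x := by
        rw [div_le_div_iff₀ hp' (hπ x)]
        -- `p·π̃(x)·(μ_0(x_0)μ_l(x_l)) ≤ p'·π̃(y₀)·(μ_0(x_0)μ_l(x_l))`
        have key : p * tensorFun μ x * (μ 0 (x 0) * μ (κ r).succ (x (κ r).succ))
            ≤ p' * tensorFun μ y₀ * (μ 0 (x 0) * μ (κ r).succ (x (κ r).succ)) := by
          rw [hy₀, show p' * tensorFun μ (edgeFlowSwap (φ r) (e r).1 (e r).2 x) * (μ 0 (x 0) * μ (κ r).succ (x (κ r).succ))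
              = p' * (tensorFun μ (edgeFlowSwap (φ r) 0 (κ r).succ x) * (μ 0 (x 0) * μ (κ r).succ (x (κ r).succ))) by
                simp only [he_def]; ring, hsw]
          -- now: `p·π̃x·μ_0(x_0)μ_l(x_l) ≤ p'·π̃x·μ_0(φ⁻¹x_l)μ_l(φx_0)`
          have hb : p * (μ 0 (x 0) * μ (κ r).succ (x (κ r).succ))
              ≤ p' * (μ 0 ((φ r).symm (x (κ r).succ)) * μ (κ r).succ (φ r (x 0))) := by
            calc p * (μ 0 (x 0) * μ (κ r).succ (x (κ r).succ))
                = (p * μ (κ r).succ (x (κ r).succ)) * μ 0 (x 0) := by ring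
              _ ≤ μ 0 ((φ r).symm (x (κ r).succ)) * (p' * μ (κ r).succ (φ r (x 0))) :=
                  mul_le_mul h1 h2 (hμ _ _).le (le_trans (mul_nonneg hp0.le (hμ _ _).le) h1)
              _ = p' * (μ 0 ((φ r).symm (x (κ r).succ)) * μ (κ r).succ (φ r (x 0))) := by ring
          have := mul_le_mul_of_nonneg_left hb (hπ x).le
          linarith [this]
        exact le_of_mul_le_mul_right (by linarith [key]) hpos
      have hpp : p / p' ≤ 1 := by
        rw [div_le_one hp']
        -- `p ≤ p'` at the label `φ_r x_0`
        have hz := htight r (φ r (x 0)) ((hφA r _).2 hx0)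
        rw [Equiv.symm_apply_apply] at hz
        have hd := hdom r (x 0)
        nlinarith [hμ (κ r).succ (φ r (x 0)), hz, hd]
      exact le_min hpp hratio
    · rw [if_neg hl]
      split_ifs
      · exact mul_nonneg (by positivity) (le_min zero_le_one (div_nonneg (hπ _).le (hπ x).le))
      · exact le_rfl
  have hsum := sum_le_sum fun r (_ : r ∈ (univ : Finset (Fin m))) => hentry r
  refine le_trans ?_ (mul_le_mul_of_nonneg_left hsum ht0)
  -- Step 4: count the entries at unlabelled levels: `≥ c·(K − V(x))`
  rw [Finset.sum_ite, Finset.sum_const_zero, add_zero, sum_const, nsmul_eq_mul]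
  have hcount : (c : ℝ) * ((K - V x : ℕ) : ℝ) ≤ ((univ.filter (fun r : Fin m => x (κ r).succ ∉ A)).card : ℝ) := by
    have h : (univ.filter (fun r : Fin m => x (κ r).succ ∉ A)).card
        = ∑ k ∈ univ.filter (fun k : Fin K => x k.succ ∉ A), (univ.filter (fun r : Fin m => κ r = k)).card := by
      rw [← Finset.card_biUnion]
      · congr 1; ext r; simp [mem_biUnion, mem_filter]
      · intro k _ k' _ hkk'
        exact Finset.disjoint_filter.mpr fun r _ h h' => hkk' (h.symm.trans h')
    have h2 : ∑ k ∈ univ.filter (fun k : Fin K => x k.succ ∉ A), c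
        ≤ ∑ k ∈ univ.filter (fun k : Fin K => x k.succ ∉ A), (univ.filter (fun r : Fin m => κ r = k)).card := sum_le_sum fun k _ => hc k
    rw [sum_const, smul_eq_mul] at h2
    have hlight : (univ.filter (fun k : Fin K => x k.succ ∉ A)).card = K - V x := by
      have := Finset.card_filter_add_card_filter_not (s := (univ : Finset (Fin K))) (fun k => x k.succ ∈ A)
      rw [Finset.card_univ, Fintype.card_fin] at this
      rw [hV]; simp only; omega
    rw [hlight] at h2
    have : (((K - V x) * c : ℕ) : ℝ) ≤ ((univ.filter (fun r : Fin m => x (κ r).succ ∉ A)).card : ℝ) := by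
      exact_mod_cast h ▸ h2
    rw [Nat.cast_mul] at this
    linarith
  calc t * c * p / (m * p') * ((K - V x : ℕ) : ℝ) = t * ((p / (m * p')) * (c * ((K - V x : ℕ) : ℝ))) := by ring
    _ ≤ t * ((p / (m * p')) * ((univ.filter (fun r : Fin m => x (κ r).succ ∉ A)).card : ℝ)) :=
        mul_le_mul_of_nonneg_left (mul_le_mul_of_nonneg_left hcount (by positivity)) ht0
    _ = t * (((univ.filter (fun r : Fin m => x (κ r).succ ∉ A)).card : ℝ) * (1 / m * (p / p'))) := by ring


end Star

end Summit.Ventures.LatticeQCDFlow.Scaling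

end
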